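import Summits.QuantumFields.YangMills.Theorems.FemtoTransferGapSpectralSumsRatio
import Summits.QuantumFields.YangMills.Theorems.FemtoTransferGapSpectralSums
import HarnessLib

/-!
# Route `LuscherReduction`, item `DressedRitz` (stmt-QuantumFields-20205), line «polyakovlift», stub S-PSCAL″ — THE DRESSED CLAUSES (o0′)(o5′)(o6′) FROM
# NORM-CURRENCY CONCENTRATION (F9 layer D4, the spectral half of the assembly; LEAD prover ym-lead-20205-polyakovlift g2)

Fixed lattice (any `L`), coupling `β`.  INPUT: the adapted eigen-data in the exact shape of `SpecSum.exists_spectral_eigenseq` (orthonormal frame `e_k`, dressed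
`HasSum`s, Bessel — taken as HYPOTHESES so that the caller's frame is shared), physical vectors `v_i` (`i : Fin k`) each CONCENTRATED in norm currency in a spectral
window `[lo_i, hi_i) ∋ i+1` of the levels `λ_j = levelValue … j` (`‖v_i‖² ≤ (1+ϑ)·Σ_{lo_i ≤ j < hi_i}⟨v_i,e_j⟩²`), window data (spread `σ`, floor `λ_low`, power
ratio `Γ`), a tolerance `0 ≤ τ ≤ 1` with the two scalar smallness conditions of `SpecSum.ratio_two_sided`, and the gap condition `λ_{hi_i} ≤ e^{−τ}λ_low`.
OUTPUT (★★ `dressed_clauses_of_concentration`) for the dressed vectors `w_i = K^n v_i`, `N_i = ‖w_i‖²`, `D_i = ⟨w_i, Kw_i⟩`, `ρ_i = D_i/N_i`: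
(o0′) `N_i > 0`; (o5′) `D_i ≤ e^{τ}λ_{i+1}N_i`, `λ_{i+1}N_i ≤ e^{τ}D_i`; (o6′) `|⟨w_i, Kw_l⟩ − ½(ρ_i+ρ_l)⟨w_i,w_l⟩| ≤ Ω·√N_i√N_l` (`i ≠ l`) with the explicit
`Ω = (1+ϑ)Γ(σ + (e^{τ}−1)λ_0 + 2√ϑ(e^{τ}λ_0 − e^{−τ}λ_low) + e^{(2n+1)τ}λ_0ϑ/(2n+1))` — engines `SpecSum.ratio_two_sided`, `SpecSum.cross_sharp`.

HONEST FRAMING: fixed-lattice spectral bookkeeping (conditional femto rung R2b1); nothing here bears on infinite volume, the continuum limit or the Clay gap.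
References: Reed–Simon IV, Thm. XIII.1 [cite: ReedSimonIV1978, Thm. XIII.1]; M. Lüscher, NPB 219 (1983) 233 [cite: Luscher1983, §3].
-/

set_option autoImplicit false

noncomputable section

open MeasureTheory Filter Topology Real Finset
open Literature.MathematicalPhysics.QuantumFieldTheory (GaugeConfig Site gaugeTransform)
open scoped BigOperators

namespace Summit.QuantumFields.YangMills.Theorems.FemtoTransferGap.PScal

open Summit.QuantumFields.YangMills.Theorems.FemtoTransferGap
open Summit.QuantumFields.YangMills.Theorems.FemtoTransferGap.SpecSum (ratio_two_sided cross_sharp dressed_norm_lower sum_le_of_hasSum)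

variable {L : ℕ} [NeZero L]

/-! ## §1 The dressed series of a physical vector in the adapted frame -/

section Series

variable {β : ℝ} {e : ℕ → GaugeConfig 3 L SU2 → ℝ}
  (hsum : ∀ (v w : GaugeConfig 3 L SU2 → ℝ), IsPhys v → IsPhys w → ∀ m n : ℕ, 1 ≤ m + n →
    HasSum (fun k => levelValue su2Rep L β k ^ (m + n) * l2 w (e k) * l2 v (e k))
      (l2 ((transferApply β)^[m] w) ((transferApply β)^[n] v)))

include hsum in
/-- `N = ‖K^n v‖² = Σ λ_k^{2n} a_k²` (`n ≥ 1`). [cite: ReedSimonIV1978, Thm. XIII.1] -/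
theorem hasSum_N {v : GaugeConfig 3 L SU2 → ℝ} (hv : IsPhys v) {n : ℕ} (hn : 1 ≤ n) :
    HasSum (fun k => levelValue su2Rep L β k ^ (2 * n) * l2 v (e k) ^ 2)
      (l2 ((transferApply β)^[n] v) ((transferApply β)^[n] v)) := by
  have h := hsum v v hv hv n n (by omega)
  refine h.congr_fun fun k => ?_
  rw [show n + n = 2 * n by ring]; ring

include hsum in
/-- `D = ⟨K^n v, K(K^n v)⟩ = Σ λ_k^{2n+1} a_k²`. [cite: ReedSimonIV1978, Thm. XIII.1] -/
theorem hasSum_D {v : GaugeConfig 3 L SU2 → ℝ} (hv : IsPhys v) (n : ℕ) (hn : 1 ≤ n) :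
    HasSum (fun k => levelValue su2Rep L β k ^ (2 * n + 1) * l2 v (e k) ^ 2)
      (l2 ((transferApply β)^[n] v) (transferApply β ((transferApply β)^[n] v))) := by
  have h := hsum v v hv hv n (n + 1) (by omega)
  rw [Function.iterate_succ_apply'] at h
  refine h.congr_fun fun k => ?_
  rw [show n + (n + 1) = 2 * n + 1 by ring]; ring

include hsum in
/-- `N_{ab} = ⟨K^n w, K^n v⟩ = Σ λ_k^{2n} a_k b_k`. [cite: ReedSimonIV1978, Thm. XIII.1] -/
theorem hasSum_Nab {v w : GaugeConfig 3 L SU2 → ℝ} (hv : IsPhys v) (hw : IsPhys w) {n : ℕ} (hn : 1 ≤ n) :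
    HasSum (fun k => levelValue su2Rep L β k ^ (2 * n) * (l2 w (e k) * l2 v (e k)))
      (l2 ((transferApply β)^[n] w) ((transferApply β)^[n] v)) := by
  have h := hsum v w hv hw n n (by omega)
  refine h.congr_fun fun k => ?_
  rw [show n + n = 2 * n by ring]; ring

include hsum in
/-- `D_{ab} = ⟨K^n w, K(K^n v)⟩ = Σ λ_k^{2n+1} a_k b_k`. [cite: ReedSimonIV1978, Thm. XIII.1] -/
theorem hasSum_Dab {v w : GaugeConfig 3 L SU2 → ℝ} (hv : IsPhys v) (hw : IsPhys w) (n : ℕ) (hn : 1 ≤ n) :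
    HasSum (fun k => levelValue su2Rep L β k ^ (2 * n + 1) * (l2 w (e k) * l2 v (e k)))
      (l2 ((transferApply β)^[n] w) (transferApply β ((transferApply β)^[n] v))) := by
  have h := hsum v w hv hw n (n + 1) (by omega)
  rw [Function.iterate_succ_apply'] at h
  refine h.congr_fun fun k => ?_
  rw [show n + (n + 1) = 2 * n + 1 by ring]; ring

end Series

/-! ## §2 Two scalar facts about a ratio pinned to `e^{±τ}` -/

/-- If `D ≤ e^{τ}λN` and `λN ≤ e^{τ}D` with `N > 0`, `λ ≥ 0`, then `|D/N − λ| ≤ (e^{τ} − 1)λ`. [folklore] -/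
theorem abs_ratio_sub_le {D N lam τ : ℝ} (hN : 0 < N) (hlam : 0 ≤ lam) (hτ : 0 ≤ τ) (h1 : D ≤ Real.exp τ * (lam * N))
    (h2 : lam * N ≤ Real.exp τ * D) : |D / N - lam| ≤ (Real.exp τ - 1) * lam := by
  have he : 1 ≤ Real.exp τ := Real.one_le_exp hτ
  have hup : D / N ≤ Real.exp τ * lam := by rw [div_le_iff₀ hN]; linarith
  have hlo : Real.exp (-τ) * lam ≤ D / N := by
    rw [le_div_iff₀ hN, Real.exp_neg]
    have hpos : 0 < Real.exp τ := Real.exp_pos τ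
    rw [inv_mul_eq_div, div_mul_eq_mul_div, div_le_iff₀ hpos]
    linarith
  -- `e^{-τ} ≥ 2 − e^{τ}` (convexity: e^{τ} + e^{−τ} ≥ 2)
  have hconv : 2 - Real.exp τ ≤ Real.exp (-τ) := by
    have h := Real.add_one_le_exp τ
    have h' := Real.add_one_le_exp (-τ)
    have hprod : Real.exp τ * Real.exp (-τ) = 1 := by rw [← Real.exp_add, add_neg_cancel, Real.exp_zero]
    nlinarith [Real.exp_pos τ, Real.exp_pos (-τ)]
  rw [abs_le]
  constructor
  · have : (2 - Real.exp τ) * lam ≤ Real.exp (-τ) * lam := mul_le_mul_of_nonneg_right hconv hlam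
    linarith
  · linarith

/-- A ratio pinned to `e^{±τ}λ` lies in `[e^{−τ}λ, e^{τ}λ]`. [folklore] -/
theorem ratio_mem_Icc {D N lam τ : ℝ} (hN : 0 < N) (h1 : D ≤ Real.exp τ * (lam * N)) (h2 : lam * N ≤ Real.exp τ * D) :
    Real.exp (-τ) * lam ≤ D / N ∧ D / N ≤ Real.exp τ * lam := by
  constructor
  · rw [le_div_iff₀ hN, Real.exp_neg]
    have hpos : 0 < Real.exp τ := Real.exp_pos τ
    rw [inv_mul_eq_div, div_mul_eq_mul_div, div_le_iff₀ hpos]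
    linarith
  · rw [div_le_iff₀ hN]; linarith

/-! ## §3 ★★ The dressed clauses -/

/-- Pure-algebra step of the cross clause: `Γ·c·((√p·x)(√p·y)) = (Γ·p)·c·(x·y)` with `p = (√p)²`. [folklore] -/
theorem cross_rearrange (Γ c p x y : ℝ) (hp : 0 ≤ p) :
    Γ * p * c * (x * y) = Γ * c * ((Real.sqrt p * x) * (Real.sqrt p * y)) := by
  have e : Real.sqrt p * Real.sqrt p = p := Real.mul_self_sqrt hp
  calc Γ * p * c * (x * y) = Γ * (Real.sqrt p * Real.sqrt p) * c * (x * y) := by rw [e]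
    _ = Γ * c * ((Real.sqrt p * x) * (Real.sqrt p * y)) := by ring

/-- ★★ **(o0′)(o5′)(o6′) from norm-currency concentration.**  See the module docstring for the dictionary. [cite: ReedSimonIV1978, Thm. XIII.1] [cite: Luscher1983, §3] -/
theorem dressed_clauses_of_concentration {β : ℝ} {e : ℕ → GaugeConfig 3 L SU2 → ℝ}
    (hsum : ∀ (v w : GaugeConfig 3 L SU2 → ℝ), IsPhys v → IsPhys w → ∀ m n : ℕ, 1 ≤ m + n →
      HasSum (fun k => levelValue su2Rep L β k ^ (m + n) * l2 w (e k) * l2 v (e k))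
        (l2 ((transferApply β)^[m] w) ((transferApply β)^[n] v)))
    (hbes : ∀ v : GaugeConfig 3 L SU2 → ℝ, IsPhys v → Summable (fun k => l2 v (e k) ^ 2) ∧ ∑' k, l2 v (e k) ^ 2 ≤ l2 v v)
    (hanti : Antitone fun k => levelValue su2Rep L β k) (hnn : ∀ k, 0 ≤ levelValue su2Rep L β k)
    {n : ℕ} (hn : 1 ≤ n) {kk : ℕ} (v : Fin kk → GaugeConfig 3 L SU2 → ℝ) (hv : ∀ i, IsPhys (v i))
    (lo hi : Fin kk → ℕ) (hlo : ∀ i : Fin kk, lo i ≤ (i : ℕ) + 1) (hhi : ∀ i : Fin kk, (i : ℕ) + 1 < hi i)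
    {σ lamlow Γ ϑ τ : ℝ}
    (hσ : ∀ (i : Fin kk) (k : ℕ), lo i ≤ k → k < hi i → |levelValue su2Rep L β k - levelValue su2Rep L β ((i : ℕ) + 1)| ≤ σ)
    (hlow0 : 0 < lamlow) (hlow : ∀ (i : Fin kk) (k : ℕ), lo i ≤ k → k < hi i → lamlow ≤ levelValue su2Rep L β k)
    (hΓ : levelValue su2Rep L β 0 ^ (2 * n) ≤ Γ * lamlow ^ (2 * n))
    (hϑ0 : 0 ≤ ϑ)
    (hconc : ∀ i : Fin kk, l2 (v i) (v i) ≤ (1 + ϑ) * ∑ k ∈ Ico (lo i) (hi i), l2 (v i) (e k) ^ 2)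
    (hin : ∀ i : Fin kk, 0 < ∑ k ∈ Ico (lo i) (hi i), l2 (v i) (e k) ^ 2)
    (hτ0 : 0 ≤ τ) (hτ1 : τ ≤ 1)
    (hup : ∀ i : Fin kk, Γ * ((levelValue su2Rep L β 0 - levelValue su2Rep L β ((i : ℕ) + 1)) * ϑ + σ) ≤ τ * levelValue su2Rep L β ((i : ℕ) + 1))
    (hlo' : ∀ i : Fin kk, Γ * (σ + levelValue su2Rep L β ((i : ℕ) + 1) * ϑ / (2 * (n : ℝ) + 1)) ≤ τ / 2 * levelValue su2Rep L β ((i : ℕ) + 1))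
    (hgapτ : ∀ i : Fin kk, levelValue su2Rep L β (hi i) ≤ Real.exp (-τ) * lamlow) :
    (∀ i : Fin kk, 0 < l2 ((transferApply β)^[n] (v i)) ((transferApply β)^[n] (v i))) ∧
    (∀ i : Fin kk,
      l2 ((transferApply β)^[n] (v i)) (transferApply β ((transferApply β)^[n] (v i))) ≤
          Real.exp τ * (levelValue su2Rep L β ((i : ℕ) + 1) * l2 ((transferApply β)^[n] (v i)) ((transferApply β)^[n] (v i))) ∧
        levelValue su2Rep L β ((i : ℕ) + 1) * l2 ((transferApply β)^[n] (v i)) ((transferApply β)^[n] (v i)) ≤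
          Real.exp τ * l2 ((transferApply β)^[n] (v i)) (transferApply β ((transferApply β)^[n] (v i)))) ∧
    (∀ i l : Fin kk, i ≠ l →
      |l2 ((transferApply β)^[n] (v i)) (transferApply β ((transferApply β)^[n] (v l))) -
          (l2 ((transferApply β)^[n] (v i)) (transferApply β ((transferApply β)^[n] (v i))) /
                l2 ((transferApply β)^[n] (v i)) ((transferApply β)^[n] (v i)) +
              l2 ((transferApply β)^[n] (v l)) (transferApply β ((transferApply β)^[n] (v l))) /
                l2 ((transferApply β)^[n] (v l)) ((transferApply β)^[n] (v l))) / 2 *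
            l2 ((transferApply β)^[n] (v i)) ((transferApply β)^[n] (v l))|
        ≤ ((1 + ϑ) * Γ * (σ + (Real.exp τ - 1) * levelValue su2Rep L β 0 +
              2 * Real.sqrt ϑ * (Real.exp τ * levelValue su2Rep L β 0 - Real.exp (-τ) * lamlow) +
              Real.exp ((2 * (n : ℝ) + 1) * τ) * levelValue su2Rep L β 0 * ϑ / (2 * (n : ℝ) + 1))) *
          (Real.sqrt (l2 ((transferApply β)^[n] (v i)) ((transferApply β)^[n] (v i))) *
            Real.sqrt (l2 ((transferApply β)^[n] (v l)) ((transferApply β)^[n] (v l))))) := by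
  set K := transferApply (L := L) β with hKdef
  set lam : ℕ → ℝ := fun k => levelValue su2Rep L β k with hlamdef
  have hanti' : Antitone lam := hanti
  -- coefficient sequences
  set a : Fin kk → ℕ → ℝ := fun i k => l2 (v i) (e k) with hadef
  -- series
  have hN : ∀ i, HasSum (fun k => lam k ^ (2 * n) * a i k ^ 2) (l2 (K^[n] (v i)) (K^[n] (v i))) := fun i => hasSum_N hsum (hv i) hn
  have hD : ∀ i, HasSum (fun k => lam k ^ (2 * n + 1) * a i k ^ 2) (l2 (K^[n] (v i)) (K (K^[n] (v i)))) := fun i =>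
    hasSum_D hsum (hv i) n hn
  have hA : ∀ i, HasSum (fun k => a i k ^ 2) (∑' k, a i k ^ 2) := fun i => (hbes (v i) (hv i)).1.hasSum
  have hAnv : ∀ i, ∑' k, a i k ^ 2 ≤ l2 (v i) (v i) := fun i => (hbes (v i) (hv i)).2
  have hposc : ∀ i : Fin kk, 0 < lam ((i : ℕ) + 1) := fun i => lt_of_lt_of_le hlow0 (hlow i _ (hlo i) (hhi i))
  -- per-vector ratio clause
  have hR : ∀ i, 0 < l2 (K^[n] (v i)) (K^[n] (v i)) ∧
      l2 (K^[n] (v i)) (K (K^[n] (v i))) ≤ Real.exp τ * (lam ((i : ℕ) + 1) * l2 (K^[n] (v i)) (K^[n] (v i))) ∧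
      lam ((i : ℕ) + 1) * l2 (K^[n] (v i)) (K^[n] (v i)) ≤ Real.exp τ * l2 (K^[n] (v i)) (K (K^[n] (v i))) := fun i =>
    ratio_two_sided hanti' hnn n (hlo i) (hhi i) (hσ i) (hN i) (hD i) (hA i) (hAnv i) (hposc i) hlow0 (hlow i) hΓ hϑ0
      (hconc i) (hin i) hτ0 hτ1 (hup i) (hlo' i)
  refine ⟨fun i => (hR i).1, fun i => (hR i).2, ?_⟩
  -- the cross clause
  intro i l hil
  have hNi := (hR i).1
  have hNl := (hR l).1
  set Ni := l2 (K^[n] (v i)) (K^[n] (v i)) with hNidef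
  set Nl := l2 (K^[n] (v l)) (K^[n] (v l)) with hNldef
  set Di := l2 (K^[n] (v i)) (K (K^[n] (v i))) with hDidef
  set Dl := l2 (K^[n] (v l)) (K (K^[n] (v l))) with hDldef
  set ρi := Di / Ni with hρi
  set ρl := Dl / Nl with hρl
  set κ := (ρi + ρl) / 2 with hκdef
  have hmemi := ratio_mem_Icc hNi (hR i).2.1 (hR i).2.2
  have hmeml := ratio_mem_Icc hNl (hR l).2.1 (hR l).2.2
  have hposi := hposc i
  have hposl := hposc l
  have he1 : 1 ≤ Real.exp τ := Real.one_le_exp hτ0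
  have heτ : 0 < Real.exp (-τ) := Real.exp_pos _
  have heτ1 : Real.exp (-τ) ≤ 1 := by rw [Real.exp_neg]; exact inv_le_one_of_one_le₀ he1
  have hlowi : lamlow ≤ lam ((i : ℕ) + 1) := hlow i _ (hlo i) (hhi i)
  have hlowl : lamlow ≤ lam ((l : ℕ) + 1) := hlow l _ (hlo l) (hhi l)
  have hl0i : lam ((i : ℕ) + 1) ≤ lam 0 := hanti' (Nat.zero_le _)
  have hl0l : lam ((l : ℕ) + 1) ≤ lam 0 := hanti' (Nat.zero_le _)
  -- κ ∈ [e^{-τ}λ_low, e^{τ}λ_0]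
  have hκlo : Real.exp (-τ) * lamlow ≤ κ := by
    have h1 : Real.exp (-τ) * lamlow ≤ ρi := le_trans (mul_le_mul_of_nonneg_left hlowi heτ.le) hmemi.1
    have h2 : Real.exp (-τ) * lamlow ≤ ρl := le_trans (mul_le_mul_of_nonneg_left hlowl heτ.le) hmeml.1
    rw [hκdef]; linarith
  have hκhi : κ ≤ Real.exp τ * lam 0 := by
    have h1 : ρi ≤ Real.exp τ * lam 0 := hmemi.2.trans (mul_le_mul_of_nonneg_left hl0i (Real.exp_pos τ).le)
    have h2 : ρl ≤ Real.exp τ * lam 0 := hmeml.2.trans (mul_le_mul_of_nonneg_left hl0l (Real.exp_pos τ).le)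
    rw [hκdef]; linarith
  have hκ0 : 0 ≤ κ := le_trans (mul_nonneg heτ.le hlow0.le) hκlo
  -- cut index
  set M := max (hi i) (hi l) with hMdef
  have hκM : lam M ≤ κ := by
    have h1 : lam M ≤ lam (hi i) := hanti' (le_max_left _ _)
    exact (h1.trans (hgapτ i)).trans hκlo
  -- windows
  have hWi : Ico (lo i) (hi i) ⊆ range M := fun k hk => mem_range.2 ((mem_Ico.1 hk).2.trans_le (le_max_left _ _))
  have hWl : Ico (lo l) (hi l) ⊆ range M := fun k hk => mem_range.2 ((mem_Ico.1 hk).2.trans_le (le_max_right _ _))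
  -- weights
  set ω₀ := Real.exp τ * lam 0 - Real.exp (-τ) * lamlow with hω₀
  set ω₁ := σ + (Real.exp τ - 1) * lam 0 with hω₁
  have hσ0 : 0 ≤ σ := (abs_nonneg _).trans (hσ i _ (hlo i) (hhi i))
  have hω₀0 : 0 ≤ ω₀ := by
    rw [hω₀]
    have : Real.exp (-τ) * lamlow ≤ Real.exp τ * lam 0 := hκlo.trans hκhi
    linarith
  have hω₁0 : 0 ≤ ω₁ := by
    rw [hω₁]
    have : 0 ≤ (Real.exp τ - 1) * lam 0 := mul_nonneg (by linarith) (hnn 0)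
    linarith
  have hw₀ : ∀ k, k < M → |lam k - κ| ≤ ω₀ := by
    intro k hk
    have hk0 : lam k ≤ lam 0 := hanti' (Nat.zero_le k)
    have hklow : lamlow ≤ lam k := by
      rcases lt_max_iff.1 hk with h | h
      · have h1 : lamlow ≤ lam (hi i - 1) := hlow i _ (by have := hlo i; have := hhi i; omega) (by have := hhi i; omega)
        exact h1.trans (hanti' (by omega))
      · have h1 : lamlow ≤ lam (hi l - 1) := hlow l _ (by have := hlo l; have := hhi l; omega) (by have := hhi l; omega)
        exact h1.trans (hanti' (by omega))
    have hup' : lam k ≤ Real.exp τ * lam 0 := hk0.trans (by nlinarith [hnn 0])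
    have hdn' : Real.exp (-τ) * lamlow ≤ lam k := le_trans (by nlinarith) hklow
    rw [abs_le, hω₀]
    constructor <;> linarith
  have hw₁ : ∀ k ∈ Ico (lo i) (hi i) ∩ Ico (lo l) (hi l), |lam k - κ| ≤ ω₁ := by
    intro k hk
    rw [mem_inter, mem_Ico, mem_Ico] at hk
    have h1 : |lam k - lam ((i : ℕ) + 1)| ≤ σ := hσ i k hk.1.1 hk.1.2
    have h2 : |lam k - lam ((l : ℕ) + 1)| ≤ σ := hσ l k hk.2.1 hk.2.2
    have h3 := abs_ratio_sub_le hNi hposi.le hτ0 (hR i).2.1 (hR i).2.2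
    have h4 := abs_ratio_sub_le hNl hposl.le hτ0 (hR l).2.1 (hR l).2.2
    have h5 : (Real.exp τ - 1) * lam ((i : ℕ) + 1) ≤ (Real.exp τ - 1) * lam 0 := mul_le_mul_of_nonneg_left hl0i (by linarith)
    have h6 : (Real.exp τ - 1) * lam ((l : ℕ) + 1) ≤ (Real.exp τ - 1) * lam 0 := mul_le_mul_of_nonneg_left hl0l (by linarith)
    rw [abs_le] at h1 h2 h3 h4 ⊢
    rw [hω₁, hκdef]
    constructor <;> linarith [h1.1, h1.2, h2.1, h2.2, h3.1, h3.2, h4.1, h4.2]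
  -- positivity of the undressed norms
  have hsub : ∀ j : Fin kk, ∑ k ∈ Ico (lo j) (hi j), a j k ^ 2 ≤ l2 (v j) (v j) := fun j =>
    ((Finset.sum_le_sum_of_subset_of_nonneg (fun k hk => mem_range.2 (mem_Ico.1 hk).2) fun k _ _ => sq_nonneg (a j k)).trans
      (sum_le_of_hasSum (hA j) (fun k => sq_nonneg _) (hi j))).trans (hAnv j)
  have hnvi : 0 < l2 (v i) (v i) := lt_of_lt_of_le (hin i) (hsub i)
  have hnvl : 0 < l2 (v l) (v l) := lt_of_lt_of_le (hin l) (hsub l)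
  -- the cross series
  have hNab := hasSum_Nab hsum (hv l) (hv i) hn
  have hDab := hasSum_Dab hsum (hv l) (hv i) n hn
  have hX := cross_sharp (a := a i) (b := a l) hanti' hnn n M hκM hκ0 hNab hDab (hA i) (hA l) (hAnv i) (hAnv l) hnvi hnvl hWi hWl hϑ0
    (hconc i) (hconc l) hω₀0 hω₁0 hw₀ hw₁
  -- convert `√nv_i √nv_l` and the level powers
  have hNlow : ∀ j, lamlow ^ (2 * n) * ∑ k ∈ Ico (lo j) (hi j), a j k ^ 2 ≤ l2 (K^[n] (v j)) (K^[n] (v j)) := fun j =>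
    dressed_norm_lower hnn n hlow0.le (hlow j) (hN j)
  have hlowpow : 0 < lamlow ^ (2 * n) := pow_pos hlow0 _
  have hnvN : ∀ j, lamlow ^ (2 * n) * l2 (v j) (v j) ≤ (1 + ϑ) * l2 (K^[n] (v j)) (K^[n] (v j)) := fun j => by
    calc lamlow ^ (2 * n) * l2 (v j) (v j) ≤ lamlow ^ (2 * n) * ((1 + ϑ) * ∑ k ∈ Ico (lo j) (hi j), a j k ^ 2) :=
          mul_le_mul_of_nonneg_left (hconc j) hlowpow.le
      _ = (1 + ϑ) * (lamlow ^ (2 * n) * ∑ k ∈ Ico (lo j) (hi j), a j k ^ 2) := by ring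
      _ ≤ (1 + ϑ) * l2 (K^[n] (v j)) (K^[n] (v j)) := mul_le_mul_of_nonneg_left (hNlow j) (by linarith)
  have hsq : ∀ j, Real.sqrt (lamlow ^ (2 * n)) * Real.sqrt (l2 (v j) (v j)) ≤
      Real.sqrt (1 + ϑ) * Real.sqrt (l2 (K^[n] (v j)) (K^[n] (v j))) := fun j => by
    rw [← Real.sqrt_mul hlowpow.le, ← Real.sqrt_mul (by linarith)]
    exact Real.sqrt_le_sqrt (hnvN j)
  have hden : (0 : ℝ) < 2 * (n : ℝ) + 1 := by positivity
  have hκpow : κ ^ (2 * n + 1) ≤ Real.exp ((2 * (n : ℝ) + 1) * τ) * lam 0 * (Γ * lamlow ^ (2 * n)) := by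
    have h1 : κ ^ (2 * n + 1) ≤ (Real.exp τ * lam 0) ^ (2 * n + 1) := pow_le_pow_left₀ hκ0 hκhi _
    have h2 : (Real.exp τ * lam 0) ^ (2 * n + 1) = Real.exp ((2 * (n : ℝ) + 1) * τ) * lam 0 * lam 0 ^ (2 * n) := by
      rw [mul_pow, ← Real.exp_nat_mul, pow_succ]; push_cast; ring
    have h3 : Real.exp ((2 * (n : ℝ) + 1) * τ) * lam 0 * lam 0 ^ (2 * n) ≤
        Real.exp ((2 * (n : ℝ) + 1) * τ) * lam 0 * (Γ * lamlow ^ (2 * n)) :=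
      mul_le_mul_of_nonneg_left hΓ (mul_nonneg (Real.exp_pos _).le (hnn 0))
    linarith
  set c3 := Real.exp ((2 * (n : ℝ) + 1) * τ) * lam 0 * ϑ / (2 * (n : ℝ) + 1) with hc3
  have hc30 : 0 ≤ c3 := div_nonneg (mul_nonneg (mul_nonneg (Real.exp_pos _).le (hnn 0)) hϑ0) hden.le
  have hωsum : 0 ≤ ω₁ + 2 * Real.sqrt ϑ * ω₀ := add_nonneg hω₁0 (mul_nonneg (mul_nonneg (by norm_num) (Real.sqrt_nonneg _)) hω₀0)
  have hcoef : lam 0 ^ (2 * n) * (ω₁ + 2 * Real.sqrt ϑ * ω₀) + κ ^ (2 * n + 1) / (2 * (n : ℝ) + 1) * ϑ ≤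
      Γ * lamlow ^ (2 * n) * (ω₁ + 2 * Real.sqrt ϑ * ω₀ + c3) := by
    have h1 : lam 0 ^ (2 * n) * (ω₁ + 2 * Real.sqrt ϑ * ω₀) ≤ Γ * lamlow ^ (2 * n) * (ω₁ + 2 * Real.sqrt ϑ * ω₀) :=
      mul_le_mul_of_nonneg_right hΓ hωsum
    have h2 : κ ^ (2 * n + 1) / (2 * (n : ℝ) + 1) * ϑ ≤
        Real.exp ((2 * (n : ℝ) + 1) * τ) * lam 0 * (Γ * lamlow ^ (2 * n)) / (2 * (n : ℝ) + 1) * ϑ :=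
      mul_le_mul_of_nonneg_right (div_le_div_of_nonneg_right hκpow hden.le) hϑ0
    have e : Real.exp ((2 * (n : ℝ) + 1) * τ) * lam 0 * (Γ * lamlow ^ (2 * n)) / (2 * (n : ℝ) + 1) * ϑ =
        Γ * lamlow ^ (2 * n) * c3 := by
      rw [hc3]; field_simp
    linarith [h1, h2, e]
  -- assemble
  have hss0 : 0 ≤ Real.sqrt (l2 (v i) (v i)) * Real.sqrt (l2 (v l) (v l)) := by positivity
  have hΩ' : 0 ≤ ω₁ + 2 * Real.sqrt ϑ * ω₀ + c3 := add_nonneg hωsum hc30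
  have hΓ0 : 0 ≤ Γ := by
    have : 0 ≤ lam 0 ^ (2 * n) := pow_nonneg (hnn 0) _
    by_contra hneg
    push Not at hneg
    have : Γ * lamlow ^ (2 * n) < 0 := mul_neg_of_neg_of_pos hneg hlowpow
    linarith
  have hfin : |l2 (K^[n] (v i)) (K (K^[n] (v l))) - κ * l2 (K^[n] (v i)) (K^[n] (v l))| ≤
      (1 + ϑ) * Γ * (ω₁ + 2 * Real.sqrt ϑ * ω₀ + c3) * (Real.sqrt Ni * Real.sqrt Nl) := by
    calc |l2 (K^[n] (v i)) (K (K^[n] (v l))) - κ * l2 (K^[n] (v i)) (K^[n] (v l))|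
        ≤ (lam 0 ^ (2 * n) * (ω₁ + 2 * Real.sqrt ϑ * ω₀) + κ ^ (2 * n + 1) / (2 * (n : ℝ) + 1) * ϑ) *
            (Real.sqrt (l2 (v i) (v i)) * Real.sqrt (l2 (v l) (v l))) := hX
      _ ≤ Γ * lamlow ^ (2 * n) * (ω₁ + 2 * Real.sqrt ϑ * ω₀ + c3) *
            (Real.sqrt (l2 (v i) (v i)) * Real.sqrt (l2 (v l) (v l))) := mul_le_mul_of_nonneg_right hcoef hss0
      _ = Γ * (ω₁ + 2 * Real.sqrt ϑ * ω₀ + c3) *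
            ((Real.sqrt (lamlow ^ (2 * n)) * Real.sqrt (l2 (v i) (v i))) * (Real.sqrt (lamlow ^ (2 * n)) * Real.sqrt (l2 (v l) (v l)))) :=
          cross_rearrange Γ _ _ _ _ hlowpow.le
      _ ≤ Γ * (ω₁ + 2 * Real.sqrt ϑ * ω₀ + c3) *
            ((Real.sqrt (1 + ϑ) * Real.sqrt Ni) * (Real.sqrt (1 + ϑ) * Real.sqrt Nl)) := by
          refine mul_le_mul_of_nonneg_left ?_ (mul_nonneg hΓ0 hΩ')
          exact mul_le_mul (hsq i) (hsq l) (by positivity) (by positivity)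
      _ = (1 + ϑ) * Γ * (ω₁ + 2 * Real.sqrt ϑ * ω₀ + c3) * (Real.sqrt Ni * Real.sqrt Nl) := by
          have e3 : Real.sqrt (1 + ϑ) * Real.sqrt (1 + ϑ) = 1 + ϑ := Real.mul_self_sqrt (by linarith)
          calc Γ * (ω₁ + 2 * Real.sqrt ϑ * ω₀ + c3) * ((Real.sqrt (1 + ϑ) * Real.sqrt Ni) * (Real.sqrt (1 + ϑ) * Real.sqrt Nl))
              = (Real.sqrt (1 + ϑ) * Real.sqrt (1 + ϑ)) * Γ * (ω₁ + 2 * Real.sqrt ϑ * ω₀ + c3) * (Real.sqrt Ni * Real.sqrt Nl) := by ring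
            _ = _ := by rw [e3]
  -- the statement's constant is literally `(1+ϑ)Γ(ω₁ + 2√ϑω₀ + c3)` (the `set`s have rewritten the goal)
  exact hfin

end Summit.QuantumFields.YangMills.Theorems.FemtoTransferGap.PScal

end
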